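import Literature.NumberTheory.LFunctions.SmoothedExplicitFormulaLeftLine
import Literature.NumberTheory.LFunctions.ZetaLogDerivRePartialFraction
import HarnessLib

/-!
# The smoothed explicit formula of Heath-Brown, Ford and Kadiri, IV: Kadiri's Proposition 2.1

Topic `Literature/NumberTheory/LFunctions`. Everything in this file is PROVED (no named fact, no
definition). Fourth and last file of the in-tree proof of the smoothed explicit formula: the
REAL-PART form printed by Kadiri (Acta Arith. 117 (2005), Prop. 2.1):

  `Re Σ Λ(n) n^{-s} f(log n) = f(0)(−½ log π + ½ Re Γ'/Γ(s/2 + 1)) + Re F(s−1)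
      − Σ_ρ Re F(s−ρ) + Re((1/2iπ)∫_{(1/2)} Re Γ'/Γ(z/2) F₂(s−z)/(s−z)² dz + F₂(s)/s²)`,

here with the zeros counted with their multiplicity `m(ρ)` (Kadiri's `Z(ζ)` is the multiset of
zeros), the sum `Σ_ρ m(ρ) Re F(s−ρ)` absolutely convergent, and `F₂(s−z)/(s−z)²`, `F₂(s)/s²`
written as `F₀(s−z)`, `F₀(s)` (`F₀ = F − f(0)/z`; for her `(H₁)` test functions
`F₀ = F₂/z²`, `laplace_eq_of_H1` / `fordLaplace₀_eq_of_C2` with `p'(0) = 0`). It is obtained from the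
complex form `SmoothedEF.fordK_eq_explicit_kadiri` (`SmoothedExplicitFormulaLeftLine.lean`) by taking
real parts and regrouping the `f(0)`-terms with de la Vallée Poussin's global formula
`Re(−ζ'/ζ(s) − 1/(s−1) + Σ_ρ m(ρ)/(s−ρ)) = −½ log π + ½ Re ψ(s/2+1)`
(`re_neg_logDeriv_zeta_hadamard`, `ZetaLogDerivRePartialFraction.lean`) — exactly the last step of
Kadiri's §3.1 ("La formule d'Hadamard (voir [Dav]) permet de réécrire le terme facteur de `f(0)`").

* `Literature.NumberTheory.LFunctions.SmoothedEF.summable_zeroOrder_mul_re_fordLaplace`;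
* `Literature.NumberTheory.LFunctions.SmoothedEF.re_fordK_eq_kadiri` — Kadiri's Prop. 2.1, for an
  admissible smoothing (`IsSmoothedEFTest`) and `1/2 < Re s < 3/2`, `s ≠ 1`, `ζ(s) ≠ 0` (Kadiri
  states it for all `s`; the range covers her use `σ = 1 − 1/(R log(4γ₀ + t₀))`, `σ + δ`).

## References

* H. Kadiri, *Une région explicite sans zéros pour la fonction ζ de Riemann*, Acta Arith. 117
  (2005) = arXiv:math/0401238, Prop. 2.1, (1.1), §3.1. (`Kadiri2005`)
-/

noncomputable section

open Complex Real MeasureTheory Filter Topology Set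

namespace Literature.NumberTheory.LFunctions

namespace SmoothedEF

variable {f p p' p'' : ℝ → ℝ} {x₀ : ℝ} {s : ℂ}

/-- `Re F₀(z) = Re F(z) − f(0) Re(1/z)`. [folklore] -/
theorem re_fordLaplace₀ (f : ℝ → ℝ) (z : ℂ) :
    (fordLaplace₀ f z).re = (fordLaplace f z).re - f 0 * (1 / z).re := by
  rw [fordLaplace₀, sub_re, div_eq_mul_one_div, Complex.re_ofReal_mul]

/-- **Absolute convergence of `Σ_ρ m(ρ) Re F(s−ρ)`** (Kadiri: "l'introduction de la partie réelle
ôte les problèmes de convergence"): `Re F(s−ρ) = Re F₀(s−ρ) + f(0) Re 1/(s−ρ)` and both pieces are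
absolutely summable with the weights `m(ρ)`. [cite: Kadiri2005, Prop. 2.1] -/
theorem summable_zeroOrder_mul_re_fordLaplace (h : IsSmoothedEFTest f p p' p'' x₀)
    (hσ₁ : -(1 / 2) < s.re) (hζs : riemannZeta s ≠ 0) :
    Summable fun ρ : RHWave0.riemannZetaNontrivialZeros ↦
      (riemannZetaZeroOrder (ρ : ℂ) : ℝ) * (fordLaplace f (s - ρ)).re := by
  have h1 : Summable fun ρ : RHWave0.riemannZetaNontrivialZeros ↦
      (riemannZetaZeroOrder (ρ : ℂ) : ℝ) * (fordLaplace₀ f (s - ρ)).re := by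
    refine .of_norm ((summable_norm_zeroTerm h hσ₁ hζs).of_nonneg_of_le (fun _ ↦ norm_nonneg _)
      fun ρ ↦ ?_)
    rw [norm_mul, norm_mul, Complex.norm_intCast, Real.norm_eq_abs, Real.norm_eq_abs]
    gcongr
    exact Complex.abs_re_le_norm _
  have h2 := (summable_norm_zeroOrder_mul_re_inv_sub hζs).of_norm.mul_left (f 0)
  refine (h1.add h2).congr fun ρ ↦ ?_
  rw [re_fordLaplace₀]
  ring

/-- **Kadiri's Proposition 2.1** (the smoothed explicit formula, real-part form, zeros with
multiplicity): for an admissible smoothing `f` and `1/2 < Re s < 3/2`, `s ≠ 1`, `ζ(s) ≠ 0`,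
`Re K_f(s) = f(0)(−½ log π + ½ Re ψ(s/2+1)) + Re F(s−1) − Σ_ρ m(ρ) Re F(s−ρ)
  + Re(F₀(s) + (1/2π)∫_ℝ Re ψ((1/2+iy)/2) F₀(s − 1/2 − iy) dy)`.
[cite: Kadiri2005, Prop. 2.1] -/
theorem re_fordK_eq_kadiri (h : IsSmoothedEFTest f p p' p'' x₀) (hσ₁ : 1 / 2 < s.re)
    (hσ₂ : s.re < 3 / 2) (hs1 : s ≠ 1) (hζs : riemannZeta s ≠ 0) :
    (fordK f s).re = f 0 * (-(Real.log π) / 2 + (digamma (s / 2 + 1)).re / 2) +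
      (fordLaplace f (s - 1)).re -
      ∑' ρ : RHWave0.riemannZetaNontrivialZeros,
        (riemannZetaZeroOrder (ρ : ℂ) : ℝ) * (fordLaplace f (s - ρ)).re +
      (fordLaplace₀ f s + (1 / (2 * π) : ℂ) *
        ∫ y : ℝ, ((digamma (((((1 / 2 : ℝ)) : ℂ) + y * I) / 2)).re : ℂ) *
          fordLaplace₀ f (s - ((((1 / 2 : ℝ)) : ℂ) + y * I))).re := by
  have hσ₁' : -(1 / 2) < s.re := by linarith
  have h0 : s ≠ 0 := fun e ↦ by rw [e] at hσ₁; simp at hσ₁; linarith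
  have hmain := congrArg Complex.re (fordK_eq_explicit_kadiri h hσ₁ hσ₂ hs1 hζs)
  have hhad := re_neg_logDeriv_zeta_hadamard (by linarith) h0 hs1 hζs
  -- the zero sum: real part termwise, then split `F₀ = F − f(0)/z`
  have hsumC := (summable_norm_zeroTerm h hσ₁' hζs).of_norm
  have hsumF := summable_zeroOrder_mul_re_fordLaplace h hσ₁' hζs
  have hsumI := (summable_norm_zeroOrder_mul_re_inv_sub hζs).of_norm
  have hre_tsum : (∑' ρ : RHWave0.riemannZetaNontrivialZeros,
      (riemannZetaZeroOrder (ρ : ℂ) : ℂ) * fordLaplace₀ f (s - ρ)).re =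
      (∑' ρ : RHWave0.riemannZetaNontrivialZeros,
        (riemannZetaZeroOrder (ρ : ℂ) : ℝ) * (fordLaplace f (s - ρ)).re) -
      f 0 * ∑' ρ : RHWave0.riemannZetaNontrivialZeros,
        (riemannZetaZeroOrder (ρ : ℂ) : ℝ) * (1 / (s - ρ)).re := by
    rw [Complex.re_tsum hsumC, ← tsum_mul_left, ← hsumF.tsum_sub (hsumI.mul_left (f 0))]
    refine tsum_congr fun ρ ↦ ?_
    have e : ((riemannZetaZeroOrder (ρ : ℂ) : ℂ) * fordLaplace₀ f (s - ρ)).re =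
        (riemannZetaZeroOrder (ρ : ℂ) : ℝ) * (fordLaplace₀ f (s - ρ)).re := by
      rw [show ((riemannZetaZeroOrder (ρ : ℂ) : ℤ) : ℂ) = (((riemannZetaZeroOrder (ρ : ℂ) : ℤ) : ℝ) : ℂ) by
        norm_cast, Complex.re_ofReal_mul]
    rw [e, re_fordLaplace₀]
    ring
  rw [hmain]
  simp only [add_re, sub_re, neg_re, mul_re, Complex.ofReal_re, Complex.ofReal_im, zero_mul,
    sub_zero, neg_mul]
  rw [hre_tsum, re_fordLaplace₀ f (s - 1)]
  have e : (-(deriv riemannZeta s / riemannZeta s)).re = -(deriv riemannZeta s / riemannZeta s).re :=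
    neg_re _
  rw [e] at hhad
  linear_combination (f 0) * hhad

end SmoothedEF

end Literature.NumberTheory.LFunctions
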